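/-
Copyright (c) 2026 the pub-hodgecm-mathlib formalisation cell (harness21).  Prover seat hodgecm-mathlib-LH4-p05 (g8), Track A «(D-RAM) FOUR-FRAME» squad, helper lane on
h413 = stmt-HodgeConjecture-24833 (count-neutral).  TABLE assembly (dealer WORD #96 (2)): the once-per-datum discharge of LH4-p11 (g8)'s SIG-PureCells v1 §3 TOWER-SIGN TOKENS.
2026-09-04.
-/
import Summits.HodgeConjecture.HodgeConjecture.Theorems.F0P3cDyRamStageOneBDerivedDefs      -- ★ №6: `mstarOfRecord`, `mcOfRecord` (via №5), ★ datum `IsRamifiedQuadraticDatum`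
import Literature.NumberTheory.LocalFields.WildQuadraticDatumTrace                       -- ★ `exists_v_le_add_map_eq` (the trace hits `𝔭_F` deep enough: `𝔭_F^{⌊(m+d)∕2⌋} ⊆ Tr 𝔭_E^m`)
import Literature.NumberTheory.LocalFields.WildQuadraticDatumRefSkewScalar               -- ★ `v_refSkewScalar`, `map_refSkewScalar_eq_neg`, `refSkewScalar_ne_zero` (the reference skew scalar `t₊`)
import HarnessLib

/-!
# Crux `H413`, line LH4 «(D-RAM) FOUR-FRAME» — THE TOWER-SIGN TOKEN EXISTS: for an `E¹`-element `α` of depth `n ≡ ℓ₀ (mod 2)` with `n ≥ 3d − 2` there is a `σ`-fixed unit `e`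
# with `(α − 1)·N(ϖ)^{−(n−ℓ₀)∕2} ≡ e·t₊ (mod ϖ^{m*})` — the hypothesis `heA`∕`heB` of LH4-p11 (g8)'s pure-strata cells, discharged once per element datum

Cell `hodgecm-mathlib` (D-0151), FLOOR 0, crux item H413 = `stmt-HodgeConjecture-24833`, route `HCCMUnconditional`; squad F0∕P3c∕LH4.  THEOREMS ONLY (no `def`, no instance, no
notation, no `sorry`, default heartbeats); ★-only imports; lane `--supports stmt-HodgeConjecture-24833 --as helper`; pays NO row, states NO law.

THE MATHEMATICS ([Serre1979, Ch. V §3]; the cell's ★ `WildQuadraticDatumTrace`).  At a ramified quadratic datum `(σ, ϖ, d, t)` put `π := ϖ·σϖ` (`σ`-fixed, `|π| = |ϖ|²`),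
`ℓ₀ := d % 2`, `m* := ℓ₀ + 2d − 1` (★ `mstarOfRecord`), `t₊ := (ϖ − σϖ)·π^{−(d−ℓ₀)∕2}` (skew, `|t₊| = |ϖ|^{ℓ₀}`, ★ `v_refSkewScalar`).  For `α` with `α·σα = 1` and
`|α − 1| = |ϖ|^n`, `n ≡ ℓ₀ (mod 2)`, the element `z := (α − 1)·π^{−(n−ℓ₀)∕2}` has `|z| = |ϖ|^{ℓ₀}` and is ALMOST SKEW: `σ(α − 1) = (1 − α)∕α`, so `z + σz = (α − 1)²∕(α·π^{(n−ℓ₀)∕2})`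
is a `σ`-fixed element of valuation `|ϖ|^{n+ℓ₀}`.  By ★ `exists_v_le_add_map_eq` (the trace is onto `𝔭_F^{⌊(m+d)∕2⌋}` from `𝔭_E^m`) there is `x` with `|x| ≤ |ϖ|^{m*}` and
`x + σx = z + σz` as soon as `m* + d ≤ n + ℓ₀ + 1`, i.e. `n ≥ 3d − 2` (§1; in the DERIVED regime `n ≥ n0DerivedOfRecord d ≥ mcOfRecord d ≥ 3d − 2` — §2).  Then `z′ := z − x` is
skew, `e := z′∕t₊` is `σ`-fixed with `|e| = 1` (`|x| < |z|` since `m* > ℓ₀`), and `z − e·t₊ = x ≡ 0 (mod ϖ^{m*})` — the TOKEN of SIG-PureCells v1 §3 (`heA` with `n = n₂ = v(α−1)`,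
`heB` with `β`, `n₁`).  When `n ≢ ℓ₀ (mod 2)` NO such `e` exists (`|z| = |ϖ|^{ℓ₀+1} ≠ |e·t₊|`), and the corresponding tower has no shell layer (the pure cells' `if 2 ∣ s` is false).
* §1 `exists_towerSign_of_le` (explicit bound `mstarOfRecord d + d ≤ n + d % 2 + 1`).   §2 `exists_towerSign_of_mcOfRecord_le` (bound `mcOfRecord d ≤ n`, the derived regime).
HONEST LABEL.  Count-neutral arithmetic helper for the (β-BAL) table assembly; table∕(β-BAL)∕(β)∕T₊ row OPEN; `HC_CM` is proved only modulo the 7 printed citations (2 remaining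
named inputs: hLiu418 = `stmt-HodgeConjecture-24832`, h413 = `stmt-HodgeConjecture-24833`) until rung 0 closes.

## References
* [Serre1979] J.-P. Serre, *Local Fields*, GTM 67 (1979), Ch. V §3 (trace and different of a ramified quadratic extension).
* [Rogawski1990] J. D. Rogawski, *Automorphic Representations of Unitary Groups in Three Variables*, Ann. of Math. Stud. 123 (1990), §4.9 p. 55 (the `E¹`-elements near `1`).
-/

set_option autoImplicit false

noncomputable section

namespace Summit.HodgeConjecture.HodgeConjecture.Cruxes.H413.F0P3cDyRamTowerSignToken

open Literature.NumberTheory.Automorphic Literature.NumberTheory.Automorphic.UnitaryThreeFourFrame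
open Literature.NumberTheory.LocalFields Literature.NumberTheory.LocalFields.WildQuadraticDatum
open Summit.HodgeConjecture.HodgeConjecture.Cruxes.H413.F0P3cDyRamFourFramePieces
open Summit.HodgeConjecture.HodgeConjecture.Cruxes.H413.F0P3cDyRamStageOneBDefs
open WithZero
open scoped Valued

variable {K : Type} [Field K] [Valued K ℤᵐ⁰]

/-! ## §1  The token, with the explicit depth bound -/

/-- **THE TOWER-SIGN TOKEN EXISTS (explicit bound).**  At a ramified datum, for `α·σα = 1` with `|α − 1| = |ϖ|^n`, `n ≡ d % 2 (mod 2)` and `mstarOfRecord d + d ≤ n + d % 2 + 1`: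
there is a `σ`-fixed unit `e` with `|(ϖ^{m*})⁻¹·((α − 1)·((ϖσϖ)^{(n − d%2)∕2})⁻¹ − e·t₊)| ≤ 1`, `t₊ = (ϖ − σϖ)·((ϖσϖ)^{(d − d%2)∕2})⁻¹` — LH4-p11 (g8) SIG-PureCells v1 §3 `heA`
VERBATIM (with `n = n₂`).  [cite: Serre1979, Ch. V §3] [cite: Rogawski1990, §4.9 p. 55] -/
theorem exists_towerSign_of_le {σ : K →+* K} {ϖ : K} {d t : ℕ} (hD : IsRamifiedQuadraticDatum σ ϖ d t)
    {α : K} (hα : α * σ α = 1) {n : ℕ} (hvα : Valued.v (α - 1) = Valued.v ϖ ^ n) (hpar : n % 2 = d % 2)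
    (hn : mstarOfRecord d + d ≤ n + d % 2 + 1) :
    ∃ e : K, σ e = e ∧ Valued.v e = 1 ∧
      Valued.v ((ϖ ^ mstarOfRecord d)⁻¹ * ((α - 1) * ((ϖ * σ ϖ) ^ ((n - d % 2) / 2))⁻¹ - e * ((ϖ - σ ϖ) * ((ϖ * σ ϖ) ^ ((d - d % 2) / 2))⁻¹))) ≤ 1 := by
  obtain ⟨hσ, hvσ, hϖ, hfix, hd, h1d, ht⟩ := hD
  -- `n = 2k + ℓ₀`
  obtain ⟨k, hnk⟩ : ∃ k : ℕ, n = 2 * k + d % 2 := ⟨n / 2, by omega⟩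
  have hk : (n - d % 2) / 2 = k := by omega
  rw [hk]
  -- notation and basic valuations
  set π : K := ϖ * σ ϖ with hπdef
  set tp : K := (ϖ - σ ϖ) * ((ϖ * σ ϖ) ^ ((d - d % 2) / 2))⁻¹ with htpdef
  set z : K := (α - 1) * (π ^ k)⁻¹ with hzdef
  have hϖ0 : ϖ ≠ 0 := fun h => by rw [h, map_zero] at hϖ; exact (coe_ne_zero hϖ.symm).elim
  have hvϖ0 : Valued.v ϖ ≠ 0 := (Valuation.ne_zero_iff _).2 hϖ0
  have hσϖ0 : σ ϖ ≠ 0 := (map_ne_zero σ).2 hϖ0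
  have hπ0 : π ≠ 0 := mul_ne_zero hϖ0 hσϖ0
  have hσπ : σ π = π := by rw [hπdef, map_mul, hσ, mul_comm]
  have hvπ : Valued.v π = Valued.v ϖ ^ 2 := by rw [hπdef, map_mul, hvσ, pow_two]
  have hα0 : α ≠ 0 := fun h => by rw [h, zero_mul] at hα; exact zero_ne_one hα
  have hvαu : Valued.v α = 1 := by
    have h2 : Valued.v α * Valued.v α = 1 := by nth_rw 2 [← hvσ α]; rw [← map_mul, hα, map_one]
    rw [← pow_two] at h2
    exact ((pow_eq_one_iff).1 h2).resolve_right two_ne_zero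
  have hσα : σ α = α⁻¹ := eq_inv_of_mul_eq_one_right hα
  -- `|z| = |ϖ|^{ℓ₀}`
  have hvz : Valued.v z = Valued.v ϖ ^ (d % 2) := by
    have h1 : Valued.v (π ^ k) = Valued.v ϖ ^ (2 * k) := by rw [map_pow, hvπ, ← pow_mul]
    rw [hzdef, map_mul, map_inv₀, h1, hvα, hnk, pow_add, mul_assoc, mul_comm (Valued.v ϖ ^ (d % 2)), ← mul_assoc,
      mul_inv_cancel₀ (pow_ne_zero _ hvϖ0), one_mul]
  -- the trace of `z` is `σ`-fixed of valuation `|ϖ|^{n + ℓ₀}`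
  have hσz : σ z = -(z * α⁻¹) := by
    rw [hzdef, map_mul, map_inv₀, map_pow, hσπ, map_sub, map_one, hσα]
    field_simp
    ring
  have htr : z + σ z = z * ((α - 1) * α⁻¹) := by rw [hσz]; field_simp; ring
  have hσtr : σ (z + σ z) = z + σ z := by rw [map_add, hσ, add_comm]
  have hvtr : Valued.v (z + σ z) ≤ exp (-(2 * ((k + d % 2 : ℕ) : ℤ))) := by
    rw [htr, map_mul, hvz, map_mul, map_inv₀, hvαu, hvα, inv_one, mul_one, ← pow_add, v_varpi_pow hϖ]
    apply le_of_eq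
    congr 1
    push_cast
    omega
  -- the trace is onto deep enough: `x` with `|x| ≤ |ϖ|^{m*}` and `x + σx = z + σz`
  have hjm : (mstarOfRecord d : ℤ) + d ≤ 2 * ((k + d % 2 : ℕ) : ℤ) + 1 := by push_cast; omega
  obtain ⟨x, hvx, hx⟩ := exists_v_le_add_map_eq hσ hfix hϖ hd ht hσtr hvtr hjm
  -- `z' := z − x` is skew; `e := z' ∕ t₊`
  have htp0 : tp ≠ 0 := refSkewScalar_ne_zero hvσ hϖ hd
  have hσtp : σ tp = -tp := map_refSkewScalar_eq_neg hσ _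
  have hvtp : Valued.v tp = Valued.v ϖ ^ (d % 2) := by rw [htpdef, v_refSkewScalar hvσ hϖ hd, v_varpi_pow hϖ]
  have hskew : σ (z - x) = -(z - x) := by
    have h1 : σ x = z + σ z - x := by rw [← hx]; ring
    rw [map_sub, h1]; ring
  have hlt : Valued.v x < Valued.v z := by
    rw [hvz, v_varpi_pow hϖ]
    refine lt_of_le_of_lt hvx ?_
    rw [exp_lt_exp, mstarOfRecord]
    omega
  refine ⟨(z - x) * tp⁻¹, ?_, ?_, ?_⟩
  · rw [map_mul, map_inv₀, hskew, hσtp, neg_mul, inv_neg, mul_neg, neg_neg]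
  · rw [map_mul, map_inv₀, Valuation.map_sub_eq_of_lt_left _ hlt, hvz, hvtp, mul_inv_cancel₀ (pow_ne_zero _ hvϖ0)]
  · -- `z − e·t₊ = x`
    have hcalc : (α - 1) * ((ϖ * σ ϖ) ^ k)⁻¹ - (z - x) * tp⁻¹ * ((ϖ - σ ϖ) * ((ϖ * σ ϖ) ^ ((d - d % 2) / 2))⁻¹) = x := by
      rw [← htpdef, mul_assoc, inv_mul_cancel₀ htp0, mul_one]
      show z - (z - x) = x
      ring
    rw [hcalc, map_mul, map_inv₀, map_pow, v_varpi_pow hϖ, ← exp_neg, neg_neg]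
    calc exp ((mstarOfRecord d : ℕ) : ℤ) * Valued.v x ≤ exp ((mstarOfRecord d : ℕ) : ℤ) * exp (-(mstarOfRecord d : ℤ)) := by gcongr
      _ = 1 := by rw [← exp_add, ← exp_zero]; congr 1; simp

/-! ## §2  The token in the derived regime -/

/-- `mcOfRecord d ≤ n` implies the trace bound `mstarOfRecord d + d ≤ n + d % 2 + 1` (`m_c = 2⌊(m* + d)∕2⌋ ≥ m* + d − 1`). [cite: Rogawski1990, §4.9 p. 55] -/
theorem mstarOfRecord_add_le_of_mcOfRecord_le {d n : ℕ} (h : mcOfRecord d ≤ n) : mstarOfRecord d + d ≤ n + d % 2 + 1 := by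
  unfold mcOfRecord mstarOfRecord at *
  omega

/-- **THE TOWER-SIGN TOKEN IN THE DERIVED REGIME.**  At a ramified datum, for `α·σα = 1` with `|α − 1| = |ϖ|^n`, `n ≡ d % 2 (mod 2)` and `mcOfRecord d ≤ n` (so for every root depth of an
element datum above `n0DerivedOfRecord d`, ★ №6 `mcOfRecord_le_n0DerivedOfRecord`): the `σ`-fixed unit token `e` of §1 exists. [cite: Serre1979, Ch. V §3] [cite: Rogawski1990, §4.9 p. 55] -/
theorem exists_towerSign_of_mcOfRecord_le {σ : K →+* K} {ϖ : K} {d t : ℕ} (hD : IsRamifiedQuadraticDatum σ ϖ d t)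
    {α : K} (hα : α * σ α = 1) {n : ℕ} (hvα : Valued.v (α - 1) = Valued.v ϖ ^ n) (hpar : n % 2 = d % 2) (hn : mcOfRecord d ≤ n) :
    ∃ e : K, σ e = e ∧ Valued.v e = 1 ∧
      Valued.v ((ϖ ^ mstarOfRecord d)⁻¹ * ((α - 1) * ((ϖ * σ ϖ) ^ ((n - d % 2) / 2))⁻¹ - e * ((ϖ - σ ϖ) * ((ϖ * σ ϖ) ^ ((d - d % 2) / 2))⁻¹))) ≤ 1 :=
  exists_towerSign_of_le hD hα hvα hpar (mstarOfRecord_add_le_of_mcOfRecord_le hn)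

/-! ## §3  The token of the third tower (`β − α`, depth `n₃`) — ED. 2, append-only -/

/-- **THE TOWER-SIGN TOKEN OF `β − α` (the letter `e_C` of LH4-p11 (g8)'s T₃∕G₃ columns).**  For `α, β ∈ E¹` with `|α − 1| = |ϖ|^{n₂}`, `|β − α| = |ϖ|^{n₃}`, `n₃ ≡ d % 2 (mod 2)`,
`mcOfRecord d ≤ n₃` and `mcOfRecord d ≤ n₂`: there is a `σ`-fixed unit `e` with `|(ϖ^{m*})⁻¹·((β − α)·((ϖσϖ)^{(n₃ − d%2)∕2})⁻¹ − e·t₊)| ≤ 1` — §2 at the `E¹`-element `γ := β·α⁻¹`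
(`|γ − 1| = |β − α|`), then `(β − α) = α·(γ − 1)` and the correction `(α − 1)·(γ − 1)·π^{−k}` is `ϖ^{m*}`-small since `n₂ ≥ m_c ≥ m*`. [cite: Serre1979, Ch. V §3] [cite: Rogawski1990, §4.9 p. 55] -/
theorem exists_towerSign_sub_of_mcOfRecord_le {σ : K →+* K} {ϖ : K} {d t : ℕ} (hD : IsRamifiedQuadraticDatum σ ϖ d t)
    {α β : K} (hα : α * σ α = 1) (hβ : β * σ β = 1) {n₂ n₃ : ℕ} (hvα : Valued.v (α - 1) = Valued.v ϖ ^ n₂) (hvβα : Valued.v (β - α) = Valued.v ϖ ^ n₃)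
    (hpar : n₃ % 2 = d % 2) (hn₃ : mcOfRecord d ≤ n₃) (hn₂ : mcOfRecord d ≤ n₂) :
    ∃ e : K, σ e = e ∧ Valued.v e = 1 ∧
      Valued.v ((ϖ ^ mstarOfRecord d)⁻¹ * ((β - α) * ((ϖ * σ ϖ) ^ ((n₃ - d % 2) / 2))⁻¹ - e * ((ϖ - σ ϖ) * ((ϖ * σ ϖ) ^ ((d - d % 2) / 2))⁻¹))) ≤ 1 := by
  obtain ⟨hσ, hvσ, hϖ, -, -, h1d, -⟩ := id hD
  have hϖ0 : ϖ ≠ 0 := fun h => by rw [h, map_zero] at hϖ; exact (coe_ne_zero hϖ.symm).elim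
  have hvϖ0 : Valued.v ϖ ≠ 0 := (Valuation.ne_zero_iff _).2 hϖ0
  have hα0 : α ≠ 0 := fun h => by rw [h, zero_mul] at hα; exact zero_ne_one hα
  have hvαu : Valued.v α = 1 := by
    have h2 : Valued.v α * Valued.v α = 1 := by nth_rw 2 [← hvσ α]; rw [← map_mul, hα, map_one]
    rw [← pow_two] at h2
    exact ((pow_eq_one_iff).1 h2).resolve_right two_ne_zero
  -- the `E¹`-element `γ := β·α⁻¹`
  set γ : K := β * α⁻¹ with hγdef
  have hγ : γ * σ γ = 1 := by
    rw [hγdef, map_mul, map_inv₀]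
    calc β * α⁻¹ * (σ β * (σ α)⁻¹) = (β * σ β) * (α * σ α)⁻¹ := by rw [mul_inv]; ring
      _ = 1 := by rw [hβ, hα, inv_one, mul_one]
  have hγ1 : γ - 1 = (β - α) * α⁻¹ := by rw [hγdef]; field_simp
  have hvγ : Valued.v (γ - 1) = Valued.v ϖ ^ n₃ := by rw [hγ1, map_mul, map_inv₀, hvαu, inv_one, mul_one, hvβα]
  obtain ⟨e, hσe, he1, he⟩ := exists_towerSign_of_mcOfRecord_le hD hγ hvγ hpar hn₃
  refine ⟨e, hσe, he1, ?_⟩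
  -- `(β − α)·π^{−k} − e·t₊ = ((γ − 1)·π^{−k} − e·t₊) + (α − 1)·(γ − 1)·π^{−k}`
  set P : K := ((ϖ * σ ϖ) ^ ((n₃ - d % 2) / 2))⁻¹ with hPdef
  set tp : K := (ϖ - σ ϖ) * ((ϖ * σ ϖ) ^ ((d - d % 2) / 2))⁻¹ with htpdef
  have hsplit : (β - α) * P - e * tp = ((γ - 1) * P - e * tp) + (α - 1) * ((γ - 1) * P) := by
    have hβα : β - α = α * (γ - 1) := by rw [hγ1]; field_simp
    rw [hβα]; ring
  -- the correction term is `ϖ^{m*}`-small: `|(α − 1)(γ − 1)P| = |ϖ|^{n₂ + ℓ₀} ≤ |ϖ|^{m*}`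
  obtain ⟨k, hnk⟩ : ∃ k : ℕ, n₃ = 2 * k + d % 2 := ⟨n₃ / 2, by omega⟩
  have hk : (n₃ - d % 2) / 2 = k := by omega
  have hvP : Valued.v ((γ - 1) * P) = Valued.v ϖ ^ (d % 2) := by
    have h1 : Valued.v ((ϖ * σ ϖ) ^ ((n₃ - d % 2) / 2)) = Valued.v ϖ ^ (2 * k) := by
      rw [hk, map_pow, map_mul, hvσ, ← pow_two, ← pow_mul]
    rw [map_mul, hPdef, map_inv₀, h1, hvγ, hnk, pow_add, mul_assoc, mul_comm (Valued.v ϖ ^ (d % 2)), ← mul_assoc,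
      mul_inv_cancel₀ (pow_ne_zero _ hvϖ0), one_mul]
  have hcorr : Valued.v ((ϖ ^ mstarOfRecord d)⁻¹ * ((α - 1) * ((γ - 1) * P))) ≤ 1 := by
    rw [map_mul, map_inv₀, map_pow, map_mul, hvα, hvP, ← pow_add, v_varpi_pow hϖ, v_varpi_pow hϖ, ← exp_neg, neg_neg, ← exp_add,
      ← exp_zero, exp_le_exp]
    have : mstarOfRecord d ≤ n₂ + d % 2 := by unfold mcOfRecord mstarOfRecord at *; omega
    push_cast
    omega
  rw [hsplit, mul_add]
  exact (Valuation.map_add _ _ _).trans (max_le he hcorr)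

end Summit.HodgeConjecture.HodgeConjecture.Cruxes.H413.F0P3cDyRamTowerSignToken

end
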